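import Mathlib
import Summits.NavierStokesRegularity.NavierStokesRegularity.Theorems.FilamentSkeletonRssAnalyticStripLiaSymbolAsymp

/-!
# Clause 13-J, brick B4 (S0 gain): `𝔖(x) ≤ (x²/4)·log x` on `(0, 1/10]` — the LIA-log lower bound of the ball-scale slice

Route `FilamentSkeletonRss`, child 28296 `Clause13NearStraight` (and its A1L twin); design of record
`filament-plan/DESIGN-NOTE-28296-tenure-g22.md` §2/§5 (slice S0: `|σ| ≥ (Γγ/4π)k²(log(2/(μk)) − 1.08)`, "the log Γ inside R² is
compensated EXACTLY by the LIA log").  From the landed Klein–Majda asymptotics `liaSym_asymp` (p653144: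
`|𝔖(x) − x²((log(x/2)+γ)/2 + ¼)| ≤ x⁴(|log x| + 1)` on `(0, ½]`) with `γ < 2/3`, `log 2 > 0.6931`: for `0 < x ≤ 1/10`,
`𝔖(x) ≤ (x²/4)·log x < 0`, i.e. `|𝔖(x)| ≥ (x²/4)·log(1/x)` (`liaSym_le_quarter_sq_mul_log`, `abs_liaSym_ge_low`).  With
`modelSelfForm_eq_spectral` (p665821) this is the S0-slice gain of the model self form.  Typing-agnostic.
Lane ns-filament-19175-p1 g13; `--supports stmt-NavierStokesRegularity-28296 --as helper`.
HONEST FRAMING: an inequality for an explicit real function attached to a HYPOTHETICAL filament skeleton on the NEGATIVE side of a MODEL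
route; nothing here bears on Navier–Stokes regularity or blow-up.
-/

noncomputable section

open Real

namespace Summit.NavierStokesRegularity.NavierStokesRegularity.Theorems.AnalyticStripLiaSymbol
set_option linter.dupNamespace false

/-- **S0 gain.** `𝔖(x) ≤ (x²/4)·log x` for `0 < x ≤ 1/10`. [folklore] -/
theorem liaSym_le_quarter_sq_mul_log (x : ℝ) (hx : 0 < x) (hx1 : x ≤ 1 / 10) :
    liaSym x ≤ x ^ 2 / 4 * Real.log x := by
  have hx2 : x ≤ 1 / 2 := by linarith
  have hasymp := (abs_le.1 (liaSym_asymp x hx hx2)).2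
  set L := Real.log x with hL
  have hLneg : L < 0 := Real.log_neg hx (by linarith)
  have habs : |Real.log x| = -L := by rw [← hL, abs_of_neg hLneg]
  have hlog2 := Real.log_two_gt_d9
  have hγ := Real.eulerMascheroniConstant_lt_two_thirds
  have hdiv : Real.log (x / 2) = L - Real.log 2 := by rw [Real.log_div hx.ne' two_ne_zero]
  -- `L ≤ log (1/8) = −3 log 2 < −2`
  have hL2 : L ≤ -2 := by
    have h1 : Real.log x ≤ Real.log (1 / 8) := Real.log_le_log hx (by linarith)
    rw [one_div, Real.log_inv, show (8:ℝ) = 2 ^ 3 by norm_num, Real.log_pow] at h1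
    push_cast at h1
    linarith
  have hxsq : x ^ 2 ≤ 1 / 100 := by nlinarith
  have hx4 : x ^ 4 ≤ x ^ 2 / 100 := by nlinarith [sq_nonneg x]
  rw [habs, hdiv] at hasymp
  -- linear facts in the atoms `x², x²L, x⁴, x⁴L`
  have h1L : 0 ≤ 1 - L := by linarith
  have h5 : x ^ 4 * (-L + 1) ≤ x ^ 2 / 100 * (-L + 1) := mul_le_mul_of_nonneg_right hx4 (by linarith)
  have h6 : x ^ 2 * ((L - Real.log 2 + Real.eulerMascheroniConstant) / 2 + 1 / 4)
      ≤ x ^ 2 * ((L - 0.6931471803 + 2 / 3) / 2 + 1 / 4) :=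
    mul_le_mul_of_nonneg_left (by linarith) (sq_nonneg x)
  have h7 : x ^ 2 * L ≤ -2 * x ^ 2 := by nlinarith [sq_nonneg x]
  have hx2pos : 0 ≤ x ^ 2 := sq_nonneg x
  nlinarith

/-- The same as a lower bound on `|𝔖|`: `(x²/4)·log(1/x) ≤ |𝔖(x)|` on `(0, 1/10]`. [folklore] -/
theorem abs_liaSym_ge_low (x : ℝ) (hx : 0 < x) (hx1 : x ≤ 1 / 10) :
    x ^ 2 / 4 * Real.log (1 / x) ≤ |liaSym x| := by
  have h := liaSym_le_quarter_sq_mul_log x hx hx1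
  have hLneg : Real.log x < 0 := Real.log_neg hx (by linarith)
  have hneg : liaSym x < 0 := by
    have : x ^ 2 / 4 * Real.log x < 0 := mul_neg_of_pos_of_neg (by positivity) hLneg
    linarith
  rw [abs_of_neg hneg, one_div, Real.log_inv]
  linarith

end Summit.NavierStokesRegularity.NavierStokesRegularity.Theorems.AnalyticStripLiaSymbol
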